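import Mathlib
import HarnessLib

/-!
# Integrals over `(−∞, c]` of functions dominated by powers `C(−y)^p`

Analysis/Calculus support file (everything proved, no definitions). For a continuous `f` with
`|f y| ≤ C (−y)^p` on `(−∞, c]` (`c < 0`, `p < −1`): `f` is integrable on `(−∞, c]` and
`∫_{(−∞,c]} |f| ≤ C (−c)^{p+1}/(−p−1)` (`integrableOn_Iic_of_rpow_bound`; reflection `y ↦ −y` and
`integral_Ioi_rpow_of_lt`). Used for the tail integrals of the reflected far side of the `ℓ = 0`
Regge–Wheeler mode (route PhotonSphereChannels, `FixedModeChannels`, stmt-FinalStateConjecture-10048).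
Folklore.
-/

noncomputable section

namespace Literature.Analysis.Calculus

open MeasureTheory Set Filter Topology

/-- Integrability on `(−∞, c]` transported from `[−c, ∞)` by `y ↦ −y`. [folklore] -/
theorem integrableOn_Iic_iff_comp_neg {g : ℝ → ℝ} {c : ℝ} :
    IntegrableOn g (Iic c) ↔ IntegrableOn (fun x => g (-x)) (Ici (-c)) := by
  have h := integrableOn_map_equiv (MeasurableEquiv.neg ℝ) (f := g) (μ := volume) (s := Iic c)
  rw [show ((volume : Measure ℝ).map (MeasurableEquiv.neg ℝ)) = volume from
    Measure.map_neg_eq_self (volume : Measure ℝ)] at h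
  rw [h]
  have hpre : (MeasurableEquiv.neg ℝ) ⁻¹' Iic c = Ici (-c) := by
    ext x
    simp only [mem_preimage, mem_Iic, mem_Ici]
    change -x ≤ c ↔ -c ≤ x
    constructor <;> intro hx <;> linarith
  rw [hpre]
  rfl

/-- **Power tails on `(−∞, c]`.** See the module docstring. [folklore] -/
theorem integrableOn_Iic_of_rpow_bound {f : ℝ → ℝ} (hf : Continuous f) {c C p : ℝ} (hc : c < 0)
    (hp : p < -1) (hb : ∀ y, y ≤ c → |f y| ≤ C * (-y) ^ p) :
    IntegrableOn f (Iic c) ∧ ∫ y in Iic c, |f y| ≤ C * (-c) ^ (p + 1) / (-p - 1) := by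
  have hc' : 0 < -c := by linarith
  -- the majorant `C (−y)^p` is integrable on `(−∞, c]` with the stated integral
  have hgI : IntegrableOn (fun x : ℝ => C * x ^ p) (Ioi (-c)) :=
    (integrableOn_Ioi_rpow_of_lt hp hc').const_mul C
  have hgI' : IntegrableOn (fun x : ℝ => C * x ^ p) (Ici (-c)) :=
    (integrableOn_Ici_iff_integrableOn_Ioi enorm_ne_top).2 hgI
  have hmajI : IntegrableOn (fun y : ℝ => C * (-y) ^ p) (Iic c) := by
    rw [integrableOn_Iic_iff_comp_neg]
    simpa only [neg_neg] using hgI'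
  have hmaj_val : ∫ y in Iic c, C * (-y) ^ p = C * (-c) ^ (p + 1) / (-p - 1) := by
    have h := integral_comp_neg_Iic c (fun x : ℝ => C * x ^ p)
    rw [h, MeasureTheory.integral_const_mul, integral_Ioi_rpow_of_lt hp hc']
    have h1 : p + 1 ≠ 0 := by linarith
    have h2 : -p - 1 ≠ 0 := by linarith
    field_simp
    ring
  have hfi : IntegrableOn f (Iic c) :=
    Integrable.mono' hmajI hf.aestronglyMeasurable ((ae_restrict_iff' measurableSet_Iic).2
      (ae_of_all _ fun y hy => by rw [Real.norm_eq_abs]; exact hb y hy))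
  refine ⟨hfi, ?_⟩
  rw [← hmaj_val]
  refine setIntegral_mono_on hfi.abs hmajI measurableSet_Iic fun y hy => hb y hy

end Literature.Analysis.Calculus
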